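/-
Copyright (c) 2026 the pub-hodgecm-mathlib formalisation cell (harness21).  Prover seat hodgecm-mathlib-F0P3-p01 (g32), Track A «(D-RAM) FOUR-FRAME», unit U2H, census leaf
(ρ2b′-X) — T5b «toric level census, type RamK», anisotropic side: level counts from DEPTH-SET EQUATIONS (coset or empty), and the RamK suppliers of those equations.  2026-09-04.
-/
import Literature.NumberTheory.LocalFields.QuadraticOrderLevelClasses        -- ★ p857317 (LH4-p08 (g4)): `hermGen_level_iff_*`, `setOf_levelGen_eq_smul_*`, `setOf_depth_eq_diff`, F1 bookkeeping
import Literature.NumberTheory.LocalFields.QuadraticOrderNormDepthTranslate  -- ★ p857502 (this seat, B1): twisted norm-depth sets are cosets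
import HarnessLib

/-!
# Level counts of quadratic-order lattices from depth-set equations (translator-free form), and the anisotropic RamK suppliers
(Jacobowitz 1962 §4; Flicker 1998 p. 84; Serre, *Local Fields* Ch. V §1, §3)

Topic `NumberTheory/LocalFields`; namespace `Literature.NumberTheory.LocalFields.QuadraticOrder`.  THEOREMS ONLY (no definition, no instance, no notation, no named fact, no
`sorry`); kernel lane `--supports stmt-HodgeConjecture-24833` (count-neutral).  Cell `pub/hodgecm-mathlib` (D-0151), crux H413, Track A, unit U2H, census leaf (ρ2b′-X).
LH4-p08 (g4)'s ★ `QuadraticOrderLevelClasses` §3 counts the order lattices `x₀·𝒪_j` of a given level through an EXACT translator `ω₀` (`η·t(ω₀) = −1`), which exists on the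
hyperbolic side.  On the ANISOTROPIC side of type RamK (`h = h₊·n₀`, `ρh₊ = −h₊`, `n₀` a non-norm unit) there is none; but all the count needs is the SHAPE of the two depth sets
`D_R = {ω : |ω| = 1, |1 + η·t(ω)| ≤ R}` at `R = exp(−(j−a))`, `R′ = exp(−(j−a+1))`: a coset `ω₀·B` of a subgroup containing `H = 𝒪_jˣ`, or empty.  §1 restates p08's three counts with
the depth-set EQUATIONS as hypotheses (`…_of_eq_smul`, `…_of_eq_smul_of_eq_empty`, `…_of_eq_empty`; `a ≥ 1` and `a = 0`); §2 supplies the equations in the anisotropic RamK letters: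
the bridge `|1 + η·t(ω)| = |n₀N(ω) − ρ(n₀N(ω))|` (`N(ω) = ωΘω`), hence `D_R = ω₁·B_R` for any member `ω₁` (★ B1) and `D_R = ∅` when no unit has twisted depth `≤ R`
(★ `QuadraticOrderNormDepthIndexTwo` §3 decides which, in terms of `c = j − a` versus `2d − 1`).  Consumed by `Theorems/F0P3cDyRamToricLevelCensusRamK` ED. 2 (− column).
HONEST LABEL: HC_CM is proved only modulo the 7 printed citations (2 remaining named inputs: hLiu418 = stmt-HodgeConjecture-24832, h413 = stmt-HodgeConjecture-24833) until rung 0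
closes; unconditional local algebra, count-neutral.

## References
* [Jacobowitz1962] R. Jacobowitz, *Hermitian forms over local fields*, Amer. J. Math. 84 (1962): §4.
* [Flicker1998UnitaryFL] Y. Flicker, p. 84 (the torus-orbit census).
* [Serre1979] J.-P. Serre, *Local Fields*, GTM 67 (1979): Ch. V §1, §3.
-/

set_option autoImplicit false

open WithZero
open scoped Pointwise Valued

namespace Literature.NumberTheory.LocalFields.QuadraticOrder

variable {K : Type*} [Field K] [Valued K ℤᵐ⁰] {ρ Θ : K →+* K} {α ϖ h : K}

/-! ## §1 The counts from depth-set equations -/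

/-- **THE COUNT, `a ≥ 1`, BOTH DEPTH SETS COSETS**: if `D_{exp(−(j−a))} = ω₀·B` and `D_{exp(−(j−a+1))} = ω₀·B′` with `H ≤ B′ ≤ B`, the order lattices with an integral Gram-primitive
dual generator of level `a` number `[B : H] − [B′ : H]`. [cite: Flicker1998UnitaryFL, p. 84] [cite: Jacobowitz1962, §4] -/
theorem ncard_levelSet_eq_relIndex_sub_of_eq_smul (hρρ : ∀ x, ρ (ρ x) = x) (hvρ : ∀ x, Valued.v (ρ x) = Valued.v x) (hΘρ : ∀ x, Θ (ρ x) = ρ (Θ x))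
    (hvΘ : ∀ x, Valued.v (Θ x) = Valued.v x) (hα : Valued.v (α - ρ α) = 1) (hϖ : Valued.v ϖ = exp (-1 : ℤ)) (hρϖ : ρ ϖ = ϖ) (hh : h ≠ 0)
    {vh : ℤ} (hvh : Valued.v h = exp (-vh)) (j : ℕ) {a : ℕ} (ha : 1 ≤ a) {k₀ : ℤ} (hk₀ : vh + 2 * k₀ + j = a)
    (H : Subgroup Kˣ) (hH : ∀ u : Kˣ, u ∈ H ↔ Valued.v (u : K) = 1 ∧ Valued.v ((u : K) - ρ u) ≤ Valued.v (ϖ ^ j * (α - ρ α)))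
    {B B' : Subgroup Kˣ} (hB'B : B' ≤ B) (hHB' : H ≤ B') {ω₀ : Kˣ}
    (hD : {ω : Kˣ | Valued.v (ω : K) = 1 ∧ Valued.v (1 + ρ h / h * (ρ ((ω : K) * Θ ω) / ((ω : K) * Θ ω))) ≤ exp (-((j : ℤ) - a))} = ω₀ • (B : Set Kˣ))
    (hD' : {ω : Kˣ | Valued.v (ω : K) = 1 ∧ Valued.v (1 + ρ h / h * (ρ ((ω : K) * Θ ω) / ((ω : K) * Θ ω))) ≤ exp (-((j : ℤ) - a + 1))} = ω₀ • (B' : Set Kˣ))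
    (hfin : ((QuotientGroup.mk : Kˣ → Kˣ ⧸ H) '' (ω₀ • (B : Set Kˣ))).Finite) :
    {Λ : AddSubgroup K | ∃ x₀ : K, x₀ ≠ 0 ∧ (∀ x, x ∈ Λ ↔ ∃ z, (Valued.v z ≤ 1 ∧ Valued.v (z - ρ z) ≤ Valued.v (ϖ ^ j * (α - ρ α))) ∧ x = x₀ * z) ∧
        ((Valued.v (h * (x₀ * Θ x₀) * (ϖ ^ j * (α - ρ α))) ≤ 1 ∧
              Valued.v (h * (x₀ * Θ x₀) * (ϖ ^ j * (α - ρ α)) - ρ (h * (x₀ * Θ x₀) * (ϖ ^ j * (α - ρ α)))) ≤ Valued.v (ϖ ^ j * (α - ρ α))) ∧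
            ¬ (Valued.v (h * (x₀ * Θ x₀) * (ϖ ^ j * (α - ρ α)) / ϖ) ≤ 1 ∧
                Valued.v (h * (x₀ * Θ x₀) * (ϖ ^ j * (α - ρ α)) / ϖ - ρ (h * (x₀ * Θ x₀) * (ϖ ^ j * (α - ρ α)) / ϖ)) ≤ Valued.v (ϖ ^ j * (α - ρ α)))) ∧
          Valued.v (h * (x₀ * Θ x₀) * (ϖ ^ j * (α - ρ α))) = exp (-(a : ℤ))}.ncard =
      H.relIndex B - H.relIndex B' := by
  have hϖ0 : ϖ ≠ 0 := (v_varpi_zpow hϖ 0).1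
  have hA := ncard_setOf_orderLattice_eq_ncard_image_mk hvρ hH (fun x₀ : Kˣ =>
    ((Valued.v (h * ((x₀ : K) * Θ x₀) * (ϖ ^ j * (α - ρ α))) ≤ 1 ∧
          Valued.v (h * ((x₀ : K) * Θ x₀) * (ϖ ^ j * (α - ρ α)) - ρ (h * ((x₀ : K) * Θ x₀) * (ϖ ^ j * (α - ρ α)))) ≤ Valued.v (ϖ ^ j * (α - ρ α))) ∧
        ¬ (Valued.v (h * ((x₀ : K) * Θ x₀) * (ϖ ^ j * (α - ρ α)) / ϖ) ≤ 1 ∧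
            Valued.v (h * ((x₀ : K) * Θ x₀) * (ϖ ^ j * (α - ρ α)) / ϖ - ρ (h * ((x₀ : K) * Θ x₀) * (ϖ ^ j * (α - ρ α)) / ϖ)) ≤ Valued.v (ϖ ^ j * (α - ρ α)))) ∧
      Valued.v (h * ((x₀ : K) * Θ x₀) * (ϖ ^ j * (α - ρ α))) = exp (-(a : ℤ)))
  have hsets : {Λ : AddSubgroup K | ∃ x₀ : K, x₀ ≠ 0 ∧ (∀ x, x ∈ Λ ↔ ∃ z, (Valued.v z ≤ 1 ∧ Valued.v (z - ρ z) ≤ Valued.v (ϖ ^ j * (α - ρ α))) ∧ x = x₀ * z) ∧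
        ((Valued.v (h * (x₀ * Θ x₀) * (ϖ ^ j * (α - ρ α))) ≤ 1 ∧
              Valued.v (h * (x₀ * Θ x₀) * (ϖ ^ j * (α - ρ α)) - ρ (h * (x₀ * Θ x₀) * (ϖ ^ j * (α - ρ α)))) ≤ Valued.v (ϖ ^ j * (α - ρ α))) ∧
            ¬ (Valued.v (h * (x₀ * Θ x₀) * (ϖ ^ j * (α - ρ α)) / ϖ) ≤ 1 ∧
                Valued.v (h * (x₀ * Θ x₀) * (ϖ ^ j * (α - ρ α)) / ϖ - ρ (h * (x₀ * Θ x₀) * (ϖ ^ j * (α - ρ α)) / ϖ)) ≤ Valued.v (ϖ ^ j * (α - ρ α)))) ∧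
          Valued.v (h * (x₀ * Θ x₀) * (ϖ ^ j * (α - ρ α))) = exp (-(a : ℤ))} =
      {Λ : AddSubgroup K | ∃ x₀ : Kˣ,
        (((Valued.v (h * ((x₀ : K) * Θ x₀) * (ϖ ^ j * (α - ρ α))) ≤ 1 ∧
              Valued.v (h * ((x₀ : K) * Θ x₀) * (ϖ ^ j * (α - ρ α)) - ρ (h * ((x₀ : K) * Θ x₀) * (ϖ ^ j * (α - ρ α)))) ≤ Valued.v (ϖ ^ j * (α - ρ α))) ∧
            ¬ (Valued.v (h * ((x₀ : K) * Θ x₀) * (ϖ ^ j * (α - ρ α)) / ϖ) ≤ 1 ∧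
                Valued.v (h * ((x₀ : K) * Θ x₀) * (ϖ ^ j * (α - ρ α)) / ϖ - ρ (h * ((x₀ : K) * Θ x₀) * (ϖ ^ j * (α - ρ α)) / ϖ)) ≤
                  Valued.v (ϖ ^ j * (α - ρ α)))) ∧
          Valued.v (h * ((x₀ : K) * Θ x₀) * (ϖ ^ j * (α - ρ α))) = exp (-(a : ℤ))) ∧
        ∀ x, x ∈ Λ ↔ ∃ y, (Valued.v y ≤ 1 ∧ Valued.v (y - ρ y) ≤ Valued.v (ϖ ^ j * (α - ρ α))) ∧ x = (x₀ : K) * y} := by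
    ext Λ
    simp only [Set.mem_setOf_eq]
    constructor
    · rintro ⟨x₀, hx₀, hmem, hP⟩; exact ⟨Units.mk0 x₀ hx₀, hP, hmem⟩
    · rintro ⟨x₀, hP, hmem⟩; exact ⟨(x₀ : K), x₀.ne_zero, hmem, hP⟩
  rw [hsets, hA, setOf_levelGen_eq_smul_of_pos hρρ hΘρ hvΘ hα hϖ hρϖ hϖ0 hh hvh j ha hk₀, ncard_image_mk_smul, setOf_depth_eq_diff, hD, hD']
  rw [ncard_image_mk_diff H (Set.smul_set_mono fun ω hω => hB'B hω) ?_ hfin, ncard_image_mk_smul_subgroup, ncard_image_mk_smul_subgroup]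
  intro x hx u hu
  obtain ⟨b, hb, rfl⟩ := Set.mem_smul_set.1 hx
  refine Set.mem_smul_set.2 ⟨u * b, B'.mul_mem (hHB' hu) hb, ?_⟩
  simp only [smul_eq_mul]; rw [mul_left_comm]

/-- **THE COUNT, `a ≥ 1`, INNER DEPTH SET EMPTY**: if `D_{exp(−(j−a))} = ω₀·B` and `D_{exp(−(j−a+1))} = ∅`, the count is `[B : H]`. [cite: Flicker1998UnitaryFL, p. 84] -/
theorem ncard_levelSet_eq_relIndex_of_eq_smul_of_eq_empty (hρρ : ∀ x, ρ (ρ x) = x) (hvρ : ∀ x, Valued.v (ρ x) = Valued.v x) (hΘρ : ∀ x, Θ (ρ x) = ρ (Θ x))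
    (hvΘ : ∀ x, Valued.v (Θ x) = Valued.v x) (hα : Valued.v (α - ρ α) = 1) (hϖ : Valued.v ϖ = exp (-1 : ℤ)) (hρϖ : ρ ϖ = ϖ) (hh : h ≠ 0)
    {vh : ℤ} (hvh : Valued.v h = exp (-vh)) (j : ℕ) {a : ℕ} (ha : 1 ≤ a) {k₀ : ℤ} (hk₀ : vh + 2 * k₀ + j = a)
    (H : Subgroup Kˣ) (hH : ∀ u : Kˣ, u ∈ H ↔ Valued.v (u : K) = 1 ∧ Valued.v ((u : K) - ρ u) ≤ Valued.v (ϖ ^ j * (α - ρ α)))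
    {B : Subgroup Kˣ} {ω₀ : Kˣ}
    (hD : {ω : Kˣ | Valued.v (ω : K) = 1 ∧ Valued.v (1 + ρ h / h * (ρ ((ω : K) * Θ ω) / ((ω : K) * Θ ω))) ≤ exp (-((j : ℤ) - a))} = ω₀ • (B : Set Kˣ))
    (hD' : {ω : Kˣ | Valued.v (ω : K) = 1 ∧ Valued.v (1 + ρ h / h * (ρ ((ω : K) * Θ ω) / ((ω : K) * Θ ω))) ≤ exp (-((j : ℤ) - a + 1))} = ∅) :
    {Λ : AddSubgroup K | ∃ x₀ : K, x₀ ≠ 0 ∧ (∀ x, x ∈ Λ ↔ ∃ z, (Valued.v z ≤ 1 ∧ Valued.v (z - ρ z) ≤ Valued.v (ϖ ^ j * (α - ρ α))) ∧ x = x₀ * z) ∧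
        ((Valued.v (h * (x₀ * Θ x₀) * (ϖ ^ j * (α - ρ α))) ≤ 1 ∧
              Valued.v (h * (x₀ * Θ x₀) * (ϖ ^ j * (α - ρ α)) - ρ (h * (x₀ * Θ x₀) * (ϖ ^ j * (α - ρ α)))) ≤ Valued.v (ϖ ^ j * (α - ρ α))) ∧
            ¬ (Valued.v (h * (x₀ * Θ x₀) * (ϖ ^ j * (α - ρ α)) / ϖ) ≤ 1 ∧
                Valued.v (h * (x₀ * Θ x₀) * (ϖ ^ j * (α - ρ α)) / ϖ - ρ (h * (x₀ * Θ x₀) * (ϖ ^ j * (α - ρ α)) / ϖ)) ≤ Valued.v (ϖ ^ j * (α - ρ α)))) ∧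
          Valued.v (h * (x₀ * Θ x₀) * (ϖ ^ j * (α - ρ α))) = exp (-(a : ℤ))}.ncard = H.relIndex B := by
  have hϖ0 : ϖ ≠ 0 := (v_varpi_zpow hϖ 0).1
  have hA := ncard_setOf_orderLattice_eq_ncard_image_mk hvρ hH (fun x₀ : Kˣ =>
    ((Valued.v (h * ((x₀ : K) * Θ x₀) * (ϖ ^ j * (α - ρ α))) ≤ 1 ∧
          Valued.v (h * ((x₀ : K) * Θ x₀) * (ϖ ^ j * (α - ρ α)) - ρ (h * ((x₀ : K) * Θ x₀) * (ϖ ^ j * (α - ρ α)))) ≤ Valued.v (ϖ ^ j * (α - ρ α))) ∧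
        ¬ (Valued.v (h * ((x₀ : K) * Θ x₀) * (ϖ ^ j * (α - ρ α)) / ϖ) ≤ 1 ∧
            Valued.v (h * ((x₀ : K) * Θ x₀) * (ϖ ^ j * (α - ρ α)) / ϖ - ρ (h * ((x₀ : K) * Θ x₀) * (ϖ ^ j * (α - ρ α)) / ϖ)) ≤ Valued.v (ϖ ^ j * (α - ρ α)))) ∧
      Valued.v (h * ((x₀ : K) * Θ x₀) * (ϖ ^ j * (α - ρ α))) = exp (-(a : ℤ)))
  have hsets : {Λ : AddSubgroup K | ∃ x₀ : K, x₀ ≠ 0 ∧ (∀ x, x ∈ Λ ↔ ∃ z, (Valued.v z ≤ 1 ∧ Valued.v (z - ρ z) ≤ Valued.v (ϖ ^ j * (α - ρ α))) ∧ x = x₀ * z) ∧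
        ((Valued.v (h * (x₀ * Θ x₀) * (ϖ ^ j * (α - ρ α))) ≤ 1 ∧
              Valued.v (h * (x₀ * Θ x₀) * (ϖ ^ j * (α - ρ α)) - ρ (h * (x₀ * Θ x₀) * (ϖ ^ j * (α - ρ α)))) ≤ Valued.v (ϖ ^ j * (α - ρ α))) ∧
            ¬ (Valued.v (h * (x₀ * Θ x₀) * (ϖ ^ j * (α - ρ α)) / ϖ) ≤ 1 ∧
                Valued.v (h * (x₀ * Θ x₀) * (ϖ ^ j * (α - ρ α)) / ϖ - ρ (h * (x₀ * Θ x₀) * (ϖ ^ j * (α - ρ α)) / ϖ)) ≤ Valued.v (ϖ ^ j * (α - ρ α)))) ∧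
          Valued.v (h * (x₀ * Θ x₀) * (ϖ ^ j * (α - ρ α))) = exp (-(a : ℤ))} =
      {Λ : AddSubgroup K | ∃ x₀ : Kˣ,
        (((Valued.v (h * ((x₀ : K) * Θ x₀) * (ϖ ^ j * (α - ρ α))) ≤ 1 ∧
              Valued.v (h * ((x₀ : K) * Θ x₀) * (ϖ ^ j * (α - ρ α)) - ρ (h * ((x₀ : K) * Θ x₀) * (ϖ ^ j * (α - ρ α)))) ≤ Valued.v (ϖ ^ j * (α - ρ α))) ∧
            ¬ (Valued.v (h * ((x₀ : K) * Θ x₀) * (ϖ ^ j * (α - ρ α)) / ϖ) ≤ 1 ∧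
                Valued.v (h * ((x₀ : K) * Θ x₀) * (ϖ ^ j * (α - ρ α)) / ϖ - ρ (h * ((x₀ : K) * Θ x₀) * (ϖ ^ j * (α - ρ α)) / ϖ)) ≤
                  Valued.v (ϖ ^ j * (α - ρ α)))) ∧
          Valued.v (h * ((x₀ : K) * Θ x₀) * (ϖ ^ j * (α - ρ α))) = exp (-(a : ℤ))) ∧
        ∀ x, x ∈ Λ ↔ ∃ y, (Valued.v y ≤ 1 ∧ Valued.v (y - ρ y) ≤ Valued.v (ϖ ^ j * (α - ρ α))) ∧ x = (x₀ : K) * y} := by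
    ext Λ
    simp only [Set.mem_setOf_eq]
    constructor
    · rintro ⟨x₀, hx₀, hmem, hP⟩; exact ⟨Units.mk0 x₀ hx₀, hP, hmem⟩
    · rintro ⟨x₀, hP, hmem⟩; exact ⟨(x₀ : K), x₀.ne_zero, hmem, hP⟩
  rw [hsets, hA, setOf_levelGen_eq_smul_of_pos hρρ hΘρ hvΘ hα hϖ hρϖ hϖ0 hh hvh j ha hk₀, ncard_image_mk_smul, setOf_depth_eq_diff, hD, hD',
    Set.sdiff_empty, ncard_image_mk_smul_subgroup]

/-- **THE COUNT, `a ≥ 1`, OUTER DEPTH SET EMPTY**: if `D_{exp(−(j−a))} = ∅`, the count is `0`. [cite: Flicker1998UnitaryFL, p. 84] -/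
theorem ncard_levelSet_eq_zero_of_eq_empty (hρρ : ∀ x, ρ (ρ x) = x) (hvρ : ∀ x, Valued.v (ρ x) = Valued.v x) (hΘρ : ∀ x, Θ (ρ x) = ρ (Θ x))
    (hvΘ : ∀ x, Valued.v (Θ x) = Valued.v x) (hα : Valued.v (α - ρ α) = 1) (hϖ : Valued.v ϖ = exp (-1 : ℤ)) (hρϖ : ρ ϖ = ϖ) (hh : h ≠ 0)
    {vh : ℤ} (hvh : Valued.v h = exp (-vh)) (j : ℕ) {a : ℕ} (ha : 1 ≤ a) {k₀ : ℤ} (hk₀ : vh + 2 * k₀ + j = a)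
    (H : Subgroup Kˣ) (hH : ∀ u : Kˣ, u ∈ H ↔ Valued.v (u : K) = 1 ∧ Valued.v ((u : K) - ρ u) ≤ Valued.v (ϖ ^ j * (α - ρ α)))
    (hD : {ω : Kˣ | Valued.v (ω : K) = 1 ∧ Valued.v (1 + ρ h / h * (ρ ((ω : K) * Θ ω) / ((ω : K) * Θ ω))) ≤ exp (-((j : ℤ) - a))} = ∅) :
    {Λ : AddSubgroup K | ∃ x₀ : K, x₀ ≠ 0 ∧ (∀ x, x ∈ Λ ↔ ∃ z, (Valued.v z ≤ 1 ∧ Valued.v (z - ρ z) ≤ Valued.v (ϖ ^ j * (α - ρ α))) ∧ x = x₀ * z) ∧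
        ((Valued.v (h * (x₀ * Θ x₀) * (ϖ ^ j * (α - ρ α))) ≤ 1 ∧
              Valued.v (h * (x₀ * Θ x₀) * (ϖ ^ j * (α - ρ α)) - ρ (h * (x₀ * Θ x₀) * (ϖ ^ j * (α - ρ α)))) ≤ Valued.v (ϖ ^ j * (α - ρ α))) ∧
            ¬ (Valued.v (h * (x₀ * Θ x₀) * (ϖ ^ j * (α - ρ α)) / ϖ) ≤ 1 ∧
                Valued.v (h * (x₀ * Θ x₀) * (ϖ ^ j * (α - ρ α)) / ϖ - ρ (h * (x₀ * Θ x₀) * (ϖ ^ j * (α - ρ α)) / ϖ)) ≤ Valued.v (ϖ ^ j * (α - ρ α)))) ∧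
          Valued.v (h * (x₀ * Θ x₀) * (ϖ ^ j * (α - ρ α))) = exp (-(a : ℤ))}.ncard = 0 := by
  have hϖ0 : ϖ ≠ 0 := (v_varpi_zpow hϖ 0).1
  have hA := ncard_setOf_orderLattice_eq_ncard_image_mk hvρ hH (fun x₀ : Kˣ =>
    ((Valued.v (h * ((x₀ : K) * Θ x₀) * (ϖ ^ j * (α - ρ α))) ≤ 1 ∧
          Valued.v (h * ((x₀ : K) * Θ x₀) * (ϖ ^ j * (α - ρ α)) - ρ (h * ((x₀ : K) * Θ x₀) * (ϖ ^ j * (α - ρ α)))) ≤ Valued.v (ϖ ^ j * (α - ρ α))) ∧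
        ¬ (Valued.v (h * ((x₀ : K) * Θ x₀) * (ϖ ^ j * (α - ρ α)) / ϖ) ≤ 1 ∧
            Valued.v (h * ((x₀ : K) * Θ x₀) * (ϖ ^ j * (α - ρ α)) / ϖ - ρ (h * ((x₀ : K) * Θ x₀) * (ϖ ^ j * (α - ρ α)) / ϖ)) ≤ Valued.v (ϖ ^ j * (α - ρ α)))) ∧
      Valued.v (h * ((x₀ : K) * Θ x₀) * (ϖ ^ j * (α - ρ α))) = exp (-(a : ℤ)))
  have hsets : {Λ : AddSubgroup K | ∃ x₀ : K, x₀ ≠ 0 ∧ (∀ x, x ∈ Λ ↔ ∃ z, (Valued.v z ≤ 1 ∧ Valued.v (z - ρ z) ≤ Valued.v (ϖ ^ j * (α - ρ α))) ∧ x = x₀ * z) ∧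
        ((Valued.v (h * (x₀ * Θ x₀) * (ϖ ^ j * (α - ρ α))) ≤ 1 ∧
              Valued.v (h * (x₀ * Θ x₀) * (ϖ ^ j * (α - ρ α)) - ρ (h * (x₀ * Θ x₀) * (ϖ ^ j * (α - ρ α)))) ≤ Valued.v (ϖ ^ j * (α - ρ α))) ∧
            ¬ (Valued.v (h * (x₀ * Θ x₀) * (ϖ ^ j * (α - ρ α)) / ϖ) ≤ 1 ∧
                Valued.v (h * (x₀ * Θ x₀) * (ϖ ^ j * (α - ρ α)) / ϖ - ρ (h * (x₀ * Θ x₀) * (ϖ ^ j * (α - ρ α)) / ϖ)) ≤ Valued.v (ϖ ^ j * (α - ρ α)))) ∧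
          Valued.v (h * (x₀ * Θ x₀) * (ϖ ^ j * (α - ρ α))) = exp (-(a : ℤ))} =
      {Λ : AddSubgroup K | ∃ x₀ : Kˣ,
        (((Valued.v (h * ((x₀ : K) * Θ x₀) * (ϖ ^ j * (α - ρ α))) ≤ 1 ∧
              Valued.v (h * ((x₀ : K) * Θ x₀) * (ϖ ^ j * (α - ρ α)) - ρ (h * ((x₀ : K) * Θ x₀) * (ϖ ^ j * (α - ρ α)))) ≤ Valued.v (ϖ ^ j * (α - ρ α))) ∧
            ¬ (Valued.v (h * ((x₀ : K) * Θ x₀) * (ϖ ^ j * (α - ρ α)) / ϖ) ≤ 1 ∧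
                Valued.v (h * ((x₀ : K) * Θ x₀) * (ϖ ^ j * (α - ρ α)) / ϖ - ρ (h * ((x₀ : K) * Θ x₀) * (ϖ ^ j * (α - ρ α)) / ϖ)) ≤
                  Valued.v (ϖ ^ j * (α - ρ α)))) ∧
          Valued.v (h * ((x₀ : K) * Θ x₀) * (ϖ ^ j * (α - ρ α))) = exp (-(a : ℤ))) ∧
        ∀ x, x ∈ Λ ↔ ∃ y, (Valued.v y ≤ 1 ∧ Valued.v (y - ρ y) ≤ Valued.v (ϖ ^ j * (α - ρ α))) ∧ x = (x₀ : K) * y} := by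
    ext Λ
    simp only [Set.mem_setOf_eq]
    constructor
    · rintro ⟨x₀, hx₀, hmem, hP⟩; exact ⟨Units.mk0 x₀ hx₀, hP, hmem⟩
    · rintro ⟨x₀, hP, hmem⟩; exact ⟨(x₀ : K), x₀.ne_zero, hmem, hP⟩
  rw [hsets, hA, setOf_levelGen_eq_smul_of_pos hρρ hΘρ hvΘ hα hϖ hρϖ hϖ0 hh hvh j ha hk₀, ncard_image_mk_smul, setOf_depth_eq_diff, hD,
    Set.empty_sdiff, Set.image_empty, Set.ncard_empty]

/-- **THE COUNT, `a = 0`, DEPTH SET A COSET**: if `D_{exp(−j)} = ω₀·B`, the level-`0` order lattices number `[B : H]`. [cite: Flicker1998UnitaryFL, p. 84] -/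
theorem ncard_levelSet_zero_eq_relIndex_of_eq_smul (hρρ : ∀ x, ρ (ρ x) = x) (hvρ : ∀ x, Valued.v (ρ x) = Valued.v x) (hΘρ : ∀ x, Θ (ρ x) = ρ (Θ x))
    (hvΘ : ∀ x, Valued.v (Θ x) = Valued.v x) (hα : Valued.v (α - ρ α) = 1) (hϖ : Valued.v ϖ = exp (-1 : ℤ)) (hρϖ : ρ ϖ = ϖ) (hh : h ≠ 0)
    {vh : ℤ} (hvh : Valued.v h = exp (-vh)) (j : ℕ) {k₀ : ℤ} (hk₀ : vh + 2 * k₀ + j = 0)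
    (H : Subgroup Kˣ) (hH : ∀ u : Kˣ, u ∈ H ↔ Valued.v (u : K) = 1 ∧ Valued.v ((u : K) - ρ u) ≤ Valued.v (ϖ ^ j * (α - ρ α)))
    {B : Subgroup Kˣ} {ω₀ : Kˣ}
    (hD : {ω : Kˣ | Valued.v (ω : K) = 1 ∧ Valued.v (1 + ρ h / h * (ρ ((ω : K) * Θ ω) / ((ω : K) * Θ ω))) ≤ exp (-(j : ℤ))} = ω₀ • (B : Set Kˣ)) :
    {Λ : AddSubgroup K | ∃ x₀ : K, x₀ ≠ 0 ∧ (∀ x, x ∈ Λ ↔ ∃ z, (Valued.v z ≤ 1 ∧ Valued.v (z - ρ z) ≤ Valued.v (ϖ ^ j * (α - ρ α))) ∧ x = x₀ * z) ∧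
        ((Valued.v (h * (x₀ * Θ x₀) * (ϖ ^ j * (α - ρ α))) ≤ 1 ∧
              Valued.v (h * (x₀ * Θ x₀) * (ϖ ^ j * (α - ρ α)) - ρ (h * (x₀ * Θ x₀) * (ϖ ^ j * (α - ρ α)))) ≤ Valued.v (ϖ ^ j * (α - ρ α))) ∧
            ¬ (Valued.v (h * (x₀ * Θ x₀) * (ϖ ^ j * (α - ρ α)) / ϖ) ≤ 1 ∧
                Valued.v (h * (x₀ * Θ x₀) * (ϖ ^ j * (α - ρ α)) / ϖ - ρ (h * (x₀ * Θ x₀) * (ϖ ^ j * (α - ρ α)) / ϖ)) ≤ Valued.v (ϖ ^ j * (α - ρ α)))) ∧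
          Valued.v (h * (x₀ * Θ x₀) * (ϖ ^ j * (α - ρ α))) = exp (-((0 : ℕ) : ℤ))}.ncard = H.relIndex B := by
  have hϖ0 : ϖ ≠ 0 := (v_varpi_zpow hϖ 0).1
  have hA := ncard_setOf_orderLattice_eq_ncard_image_mk hvρ hH (fun x₀ : Kˣ =>
    ((Valued.v (h * ((x₀ : K) * Θ x₀) * (ϖ ^ j * (α - ρ α))) ≤ 1 ∧
          Valued.v (h * ((x₀ : K) * Θ x₀) * (ϖ ^ j * (α - ρ α)) - ρ (h * ((x₀ : K) * Θ x₀) * (ϖ ^ j * (α - ρ α)))) ≤ Valued.v (ϖ ^ j * (α - ρ α))) ∧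
        ¬ (Valued.v (h * ((x₀ : K) * Θ x₀) * (ϖ ^ j * (α - ρ α)) / ϖ) ≤ 1 ∧
            Valued.v (h * ((x₀ : K) * Θ x₀) * (ϖ ^ j * (α - ρ α)) / ϖ - ρ (h * ((x₀ : K) * Θ x₀) * (ϖ ^ j * (α - ρ α)) / ϖ)) ≤ Valued.v (ϖ ^ j * (α - ρ α)))) ∧
      Valued.v (h * ((x₀ : K) * Θ x₀) * (ϖ ^ j * (α - ρ α))) = exp (-((0 : ℕ) : ℤ)))
  have hsets : {Λ : AddSubgroup K | ∃ x₀ : K, x₀ ≠ 0 ∧ (∀ x, x ∈ Λ ↔ ∃ z, (Valued.v z ≤ 1 ∧ Valued.v (z - ρ z) ≤ Valued.v (ϖ ^ j * (α - ρ α))) ∧ x = x₀ * z) ∧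
        ((Valued.v (h * (x₀ * Θ x₀) * (ϖ ^ j * (α - ρ α))) ≤ 1 ∧
              Valued.v (h * (x₀ * Θ x₀) * (ϖ ^ j * (α - ρ α)) - ρ (h * (x₀ * Θ x₀) * (ϖ ^ j * (α - ρ α)))) ≤ Valued.v (ϖ ^ j * (α - ρ α))) ∧
            ¬ (Valued.v (h * (x₀ * Θ x₀) * (ϖ ^ j * (α - ρ α)) / ϖ) ≤ 1 ∧
                Valued.v (h * (x₀ * Θ x₀) * (ϖ ^ j * (α - ρ α)) / ϖ - ρ (h * (x₀ * Θ x₀) * (ϖ ^ j * (α - ρ α)) / ϖ)) ≤ Valued.v (ϖ ^ j * (α - ρ α)))) ∧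
          Valued.v (h * (x₀ * Θ x₀) * (ϖ ^ j * (α - ρ α))) = exp (-((0 : ℕ) : ℤ))} =
      {Λ : AddSubgroup K | ∃ x₀ : Kˣ,
        (((Valued.v (h * ((x₀ : K) * Θ x₀) * (ϖ ^ j * (α - ρ α))) ≤ 1 ∧
              Valued.v (h * ((x₀ : K) * Θ x₀) * (ϖ ^ j * (α - ρ α)) - ρ (h * ((x₀ : K) * Θ x₀) * (ϖ ^ j * (α - ρ α)))) ≤ Valued.v (ϖ ^ j * (α - ρ α))) ∧
            ¬ (Valued.v (h * ((x₀ : K) * Θ x₀) * (ϖ ^ j * (α - ρ α)) / ϖ) ≤ 1 ∧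
                Valued.v (h * ((x₀ : K) * Θ x₀) * (ϖ ^ j * (α - ρ α)) / ϖ - ρ (h * ((x₀ : K) * Θ x₀) * (ϖ ^ j * (α - ρ α)) / ϖ)) ≤
                  Valued.v (ϖ ^ j * (α - ρ α)))) ∧
          Valued.v (h * ((x₀ : K) * Θ x₀) * (ϖ ^ j * (α - ρ α))) = exp (-((0 : ℕ) : ℤ))) ∧
        ∀ x, x ∈ Λ ↔ ∃ y, (Valued.v y ≤ 1 ∧ Valued.v (y - ρ y) ≤ Valued.v (ϖ ^ j * (α - ρ α))) ∧ x = (x₀ : K) * y} := by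
    ext Λ
    simp only [Set.mem_setOf_eq]
    constructor
    · rintro ⟨x₀, hx₀, hmem, hP⟩; exact ⟨Units.mk0 x₀ hx₀, hP, hmem⟩
    · rintro ⟨x₀, hP, hmem⟩; exact ⟨(x₀ : K), x₀.ne_zero, hmem, hP⟩
  rw [hsets, hA, setOf_levelGen_eq_smul_zero hρρ hΘρ hvΘ hα hϖ hρϖ hϖ0 hh hvh j hk₀, ncard_image_mk_smul, hD, ncard_image_mk_smul_subgroup]

/-- **THE COUNT, `a = 0`, DEPTH SET EMPTY**: if `D_{exp(−j)} = ∅`, no level-`0` order lattice. [cite: Flicker1998UnitaryFL, p. 84] -/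
theorem ncard_levelSet_zero_eq_zero_of_eq_empty (hρρ : ∀ x, ρ (ρ x) = x) (hvρ : ∀ x, Valued.v (ρ x) = Valued.v x) (hΘρ : ∀ x, Θ (ρ x) = ρ (Θ x))
    (hvΘ : ∀ x, Valued.v (Θ x) = Valued.v x) (hα : Valued.v (α - ρ α) = 1) (hϖ : Valued.v ϖ = exp (-1 : ℤ)) (hρϖ : ρ ϖ = ϖ) (hh : h ≠ 0)
    {vh : ℤ} (hvh : Valued.v h = exp (-vh)) (j : ℕ) {k₀ : ℤ} (hk₀ : vh + 2 * k₀ + j = 0)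
    (H : Subgroup Kˣ) (hH : ∀ u : Kˣ, u ∈ H ↔ Valued.v (u : K) = 1 ∧ Valued.v ((u : K) - ρ u) ≤ Valued.v (ϖ ^ j * (α - ρ α)))
    (hD : {ω : Kˣ | Valued.v (ω : K) = 1 ∧ Valued.v (1 + ρ h / h * (ρ ((ω : K) * Θ ω) / ((ω : K) * Θ ω))) ≤ exp (-(j : ℤ))} = ∅) :
    {Λ : AddSubgroup K | ∃ x₀ : K, x₀ ≠ 0 ∧ (∀ x, x ∈ Λ ↔ ∃ z, (Valued.v z ≤ 1 ∧ Valued.v (z - ρ z) ≤ Valued.v (ϖ ^ j * (α - ρ α))) ∧ x = x₀ * z) ∧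
        ((Valued.v (h * (x₀ * Θ x₀) * (ϖ ^ j * (α - ρ α))) ≤ 1 ∧
              Valued.v (h * (x₀ * Θ x₀) * (ϖ ^ j * (α - ρ α)) - ρ (h * (x₀ * Θ x₀) * (ϖ ^ j * (α - ρ α)))) ≤ Valued.v (ϖ ^ j * (α - ρ α))) ∧
            ¬ (Valued.v (h * (x₀ * Θ x₀) * (ϖ ^ j * (α - ρ α)) / ϖ) ≤ 1 ∧
                Valued.v (h * (x₀ * Θ x₀) * (ϖ ^ j * (α - ρ α)) / ϖ - ρ (h * (x₀ * Θ x₀) * (ϖ ^ j * (α - ρ α)) / ϖ)) ≤ Valued.v (ϖ ^ j * (α - ρ α)))) ∧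
          Valued.v (h * (x₀ * Θ x₀) * (ϖ ^ j * (α - ρ α))) = exp (-((0 : ℕ) : ℤ))}.ncard = 0 := by
  have hϖ0 : ϖ ≠ 0 := (v_varpi_zpow hϖ 0).1
  have hA := ncard_setOf_orderLattice_eq_ncard_image_mk hvρ hH (fun x₀ : Kˣ =>
    ((Valued.v (h * ((x₀ : K) * Θ x₀) * (ϖ ^ j * (α - ρ α))) ≤ 1 ∧
          Valued.v (h * ((x₀ : K) * Θ x₀) * (ϖ ^ j * (α - ρ α)) - ρ (h * ((x₀ : K) * Θ x₀) * (ϖ ^ j * (α - ρ α)))) ≤ Valued.v (ϖ ^ j * (α - ρ α))) ∧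
        ¬ (Valued.v (h * ((x₀ : K) * Θ x₀) * (ϖ ^ j * (α - ρ α)) / ϖ) ≤ 1 ∧
            Valued.v (h * ((x₀ : K) * Θ x₀) * (ϖ ^ j * (α - ρ α)) / ϖ - ρ (h * ((x₀ : K) * Θ x₀) * (ϖ ^ j * (α - ρ α)) / ϖ)) ≤ Valued.v (ϖ ^ j * (α - ρ α)))) ∧
      Valued.v (h * ((x₀ : K) * Θ x₀) * (ϖ ^ j * (α - ρ α))) = exp (-((0 : ℕ) : ℤ)))
  have hsets : {Λ : AddSubgroup K | ∃ x₀ : K, x₀ ≠ 0 ∧ (∀ x, x ∈ Λ ↔ ∃ z, (Valued.v z ≤ 1 ∧ Valued.v (z - ρ z) ≤ Valued.v (ϖ ^ j * (α - ρ α))) ∧ x = x₀ * z) ∧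
        ((Valued.v (h * (x₀ * Θ x₀) * (ϖ ^ j * (α - ρ α))) ≤ 1 ∧
              Valued.v (h * (x₀ * Θ x₀) * (ϖ ^ j * (α - ρ α)) - ρ (h * (x₀ * Θ x₀) * (ϖ ^ j * (α - ρ α)))) ≤ Valued.v (ϖ ^ j * (α - ρ α))) ∧
            ¬ (Valued.v (h * (x₀ * Θ x₀) * (ϖ ^ j * (α - ρ α)) / ϖ) ≤ 1 ∧
                Valued.v (h * (x₀ * Θ x₀) * (ϖ ^ j * (α - ρ α)) / ϖ - ρ (h * (x₀ * Θ x₀) * (ϖ ^ j * (α - ρ α)) / ϖ)) ≤ Valued.v (ϖ ^ j * (α - ρ α)))) ∧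
          Valued.v (h * (x₀ * Θ x₀) * (ϖ ^ j * (α - ρ α))) = exp (-((0 : ℕ) : ℤ))} =
      {Λ : AddSubgroup K | ∃ x₀ : Kˣ,
        (((Valued.v (h * ((x₀ : K) * Θ x₀) * (ϖ ^ j * (α - ρ α))) ≤ 1 ∧
              Valued.v (h * ((x₀ : K) * Θ x₀) * (ϖ ^ j * (α - ρ α)) - ρ (h * ((x₀ : K) * Θ x₀) * (ϖ ^ j * (α - ρ α)))) ≤ Valued.v (ϖ ^ j * (α - ρ α))) ∧
            ¬ (Valued.v (h * ((x₀ : K) * Θ x₀) * (ϖ ^ j * (α - ρ α)) / ϖ) ≤ 1 ∧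
                Valued.v (h * ((x₀ : K) * Θ x₀) * (ϖ ^ j * (α - ρ α)) / ϖ - ρ (h * ((x₀ : K) * Θ x₀) * (ϖ ^ j * (α - ρ α)) / ϖ)) ≤
                  Valued.v (ϖ ^ j * (α - ρ α)))) ∧
          Valued.v (h * ((x₀ : K) * Θ x₀) * (ϖ ^ j * (α - ρ α))) = exp (-((0 : ℕ) : ℤ))) ∧
        ∀ x, x ∈ Λ ↔ ∃ y, (Valued.v y ≤ 1 ∧ Valued.v (y - ρ y) ≤ Valued.v (ϖ ^ j * (α - ρ α))) ∧ x = (x₀ : K) * y} := by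
    ext Λ
    simp only [Set.mem_setOf_eq]
    constructor
    · rintro ⟨x₀, hx₀, hmem, hP⟩; exact ⟨Units.mk0 x₀ hx₀, hP, hmem⟩
    · rintro ⟨x₀, hP, hmem⟩; exact ⟨(x₀ : K), x₀.ne_zero, hmem, hP⟩
  rw [hsets, hA, setOf_levelGen_eq_smul_zero hρρ hΘρ hvΘ hα hϖ hρϖ hϖ0 hh hvh j hk₀, ncard_image_mk_smul, hD, Set.image_empty, Set.ncard_empty]

/-! ## §2 The anisotropic RamK suppliers: `h = h₊·n₀`, `ρh₊ = −h₊`, `n₀` a unit -/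

/-- **BRIDGE**: for `h = h₊·n₀` with `ρh₊ = −h₊` and a unit `n₀`, the ρ-depth of `1 + η·t(ω)` is the TWISTED norm depth: `|1 + ρh∕h·ρN(ω)∕N(ω)| = |n₀N(ω) − ρ(n₀N(ω))|`
(`N(ω) = ωΘω`, `ω` a unit). [cite: Jacobowitz1962, §4] -/
theorem v_one_add_twist_eq_of_antiFixed_mul (hvΘ : ∀ x, Valued.v (Θ x) = Valued.v x)
    {hp n₀ : K} (hρh : ρ hp = -hp) (hhp : hp ≠ 0) (hn₀ : Valued.v n₀ = 1) {ω : K} (hω : Valued.v ω = 1) :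
    Valued.v (1 + ρ (hp * n₀) / (hp * n₀) * (ρ (ω * Θ ω) / (ω * Θ ω))) = Valued.v (n₀ * (ω * Θ ω) - ρ (n₀ * (ω * Θ ω))) := by
  have hN1 : Valued.v (n₀ * (ω * Θ ω)) = 1 := by rw [map_mul, map_mul, hn₀, hvΘ, hω, one_mul, one_mul]
  have hN0 : n₀ * (ω * Θ ω) ≠ 0 := fun h0 => by rw [h0, map_zero] at hN1; exact zero_ne_one hN1
  have hn0 : n₀ ≠ 0 := fun h0 => hN0 (by rw [h0, zero_mul])
  have hω0 : ω ≠ 0 := fun h0 => hN0 (by rw [h0, zero_mul, mul_zero])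
  have hΘω0 : Θ ω ≠ 0 := (map_ne_zero Θ).2 hω0
  have heq : 1 + ρ (hp * n₀) / (hp * n₀) * (ρ (ω * Θ ω) / (ω * Θ ω)) = (n₀ * (ω * Θ ω) - ρ (n₀ * (ω * Θ ω))) / (n₀ * (ω * Θ ω)) := by
    rw [map_mul ρ hp n₀, hρh, map_mul ρ n₀ (ω * Θ ω)]
    field_simp
    ring
  rw [heq, map_div₀, hN1, div_one]

/-- **THE DEPTH SET IS A COSET when it has a member** (anisotropic RamK letters): if the unit `ω₁` has twisted depth `|n₀N(ω₁) − ρ(n₀N(ω₁))| ≤ r`, then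
`{ω : |ω| = 1, |1 + η·t(ω)| ≤ r} = ω₁·B_r` for `h = h₊·n₀`. [cite: Jacobowitz1962, §4] [cite: Serre1979, Ch. V §1] -/
theorem setOf_twistDepth_le_eq_smul_of_antiFixed_mul (hvρ : ∀ x, Valued.v (ρ x) = Valued.v x) (hvΘ : ∀ x, Valued.v (Θ x) = Valued.v x)
    {hp n₀ : K} (hρh : ρ hp = -hp) (hhp : hp ≠ 0) (hn₀ : Valued.v n₀ = 1) (r : ℤᵐ⁰) {ω₁ : Kˣ} (hω₁ : Valued.v (ω₁ : K) = 1)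
    (h₁ : Valued.v (n₀ * ((ω₁ : K) * Θ ω₁) - ρ (n₀ * ((ω₁ : K) * Θ ω₁))) ≤ r) {B : Subgroup Kˣ}
    (hB : ∀ ω : Kˣ, ω ∈ B ↔ Valued.v (ω : K) = 1 ∧ Valued.v ((ω : K) * Θ ω - ρ ((ω : K) * Θ ω)) ≤ r) :
    {ω : Kˣ | Valued.v (ω : K) = 1 ∧ Valued.v (1 + ρ (hp * n₀) / (hp * n₀) * (ρ ((ω : K) * Θ ω) / ((ω : K) * Θ ω))) ≤ r} = ω₁ • (B : Set Kˣ) := by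
  rw [← setOf_twistedNormDepth_le_eq_smul hvρ hvΘ hn₀ r hω₁ h₁ hB]
  ext ω
  simp only [Set.mem_setOf_eq]
  constructor
  · rintro ⟨hω, hle⟩; exact ⟨hω, by rwa [v_one_add_twist_eq_of_antiFixed_mul hvΘ hρh hhp hn₀ hω] at hle⟩
  · rintro ⟨hω, hle⟩; exact ⟨hω, by rwa [v_one_add_twist_eq_of_antiFixed_mul hvΘ hρh hhp hn₀ hω]⟩

/-- **THE DEPTH SET IS EMPTY when no unit has twisted depth `≤ r`** (anisotropic RamK letters). [cite: Jacobowitz1962, §4] -/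
theorem setOf_twistDepth_le_eq_empty_of_antiFixed_mul (hvΘ : ∀ x, Valued.v (Θ x) = Valued.v x)
    {hp n₀ : K} (hρh : ρ hp = -hp) (hhp : hp ≠ 0) (hn₀ : Valued.v n₀ = 1) (r : ℤᵐ⁰)
    (hnone : ∀ ω : K, Valued.v ω = 1 → ¬ Valued.v (n₀ * (ω * Θ ω) - ρ (n₀ * (ω * Θ ω))) ≤ r) :
    {ω : Kˣ | Valued.v (ω : K) = 1 ∧ Valued.v (1 + ρ (hp * n₀) / (hp * n₀) * (ρ ((ω : K) * Θ ω) / ((ω : K) * Θ ω))) ≤ r} = ∅ := by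
  ext ω
  simp only [Set.mem_setOf_eq, Set.mem_empty_iff_false, iff_false, not_and]
  intro hω hle
  rw [v_one_add_twist_eq_of_antiFixed_mul hvΘ hρh hhp hn₀ hω] at hle
  exact hnone _ hω hle

end Literature.NumberTheory.LocalFields.QuadraticOrder
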